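import Literature.NumberTheory.GaloisCohomology.PoitouTatePrimaryReduction
import Literature.NumberTheory.GaloisRepresentations.LocalKummerTorsion
import HarnessLib

/-!
# Level change for the archimedean invariant maps, and the primary reduction over any number field

The reduction of the reciprocity law `∑_v inv_v = 0` for THE invariant maps
(`LocalInvariants.canonical K n`) from all levels `n` to prime-power levels
(`PoitouTatePrimaryReduction.lean`: `sumInvLocalizationEqZero_canonical_of_coprime/_of_primePow`) was
proved for TOTALLY COMPLEX `K` only, the archimedean members of the family being disposed of by
`inv_w = 0` at complex places.  Over a number field with real places one needs instead the LEVEL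
COMPATIBILITIES of the archimedean invariant map `inv_w : H²(K_w, μₙ) ↪ ℤ/n` (values in `{0, n/2}`,
`Br(ℝ) = ½ℤ/ℤ`), exactly parallel to the finite ones (`localInvariantMap_localization_cohomologyMap_muInclHom/
…_muPowHom`; Serre, *Corps locaux* XIII §3: the invariant maps of all levels are compatible in `ℚ/ℤ`):

* `archimedeanInvariantMap_localization_twoCocycleClass` — `inv_w (loc_w [φ]) = φ(c_w, c_w) + φ(1, 1)`
  read in `ℤ/n`, `c_w` the complex conjugation of `Γ_K` attached to the chosen `K̄ → K̄_w`;
* `archimedeanInvariantMap_localization_cohomologyMap_muInclHom` — along `μₙ ⊆ μ_N`: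
  `inv_w^{(N)} (loc_w (ι_* x)) = (N/n) · inv_w^{(n)} (loc_w x)`;
* `archimedeanInvariantMap_localization_cohomologyMap_muPowHom` — along `μ_N ↠ μₙ` (`N = n d`):
  `inv_w^{(n)} (loc_w (π_* x)) = inv_w^{(N)} (loc_w x) mod n`;
* `canonical_localization_cohomologyMap_muInclHom/_muPowHom` — the same for the whole canonical family,
  uniformly in the place;
* **`sumInvLocalizationEqZero_canonical_of_coprime_of_numberField`**,
  **`sumInvLocalizationEqZero_canonical_of_primePow_of_numberField`** — the primary reduction for EVERY
  number field (the proofs of `PoitouTatePrimaryReduction.lean` with the uniform level changes).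

Node (N7) of the `∀ K` form of `poitouTate_sum_localTatePairing_eq_zero` (cell `bsd-cn100`, seat
transfer-2 g5).  Proof file: theorems only (no definition, no named fact, no instance; D-0026).

## References

* J.-P. Serre, *Corps locaux* (1968) / *Local Fields* (1979), XIII §3 (compatibility of `inv` in the
  tower of levels; Remarque: the case `ℝ`). [SerreLocalFields1979]
* J. S. Milne, *Arithmetic Duality Theorems* (2006), Ch. I Ex. 1.6 (c), Thm. 2.13. [MilneADT2006]
* J. Tate, in Cassels–Fröhlich (1967), Ch. VII §11. [CasselsFrohlich1967]
-/

noncomputable section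

open CategoryTheory Function NumberField IsDedekindDomain Field
open scoped NumberField

universe u

namespace Literature.NumberTheory.GaloisCohomology

open _root_.ContinuousCohomology
open Literature.NumberTheory.GaloisRepresentations
open Literature.NumberTheory.GaloisRepresentations.DiscreteGaloisModule
open Literature.AnabelianGeometry.AbsoluteAnabelian
open Literature.AnabelianGeometry.AbsoluteAnabelian.Prop121vii

/-! ### §0. The element of order two -/

/-- The only element of order dividing `2` other than `0` in `ℤ/n` is `n/2` (and then `n` is even).
[folklore] -/
private theorem zmod_eq_natCast_div_two {n : ℕ} [NeZero n] (x : ZMod n) (h2 : 2 • x = 0) (h0 : x ≠ 0) :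
    x = ((n / 2 : ℕ) : ZMod n) ∧ 2 ∣ n := by
  have hlt : x.val < n := ZMod.val_lt x
  have hpos : 0 < x.val := Nat.pos_of_ne_zero fun h => h0 ((ZMod.val_eq_zero x).mp h)
  have h2' : ((2 * x.val : ℕ) : ZMod n) = 0 := by
    rw [two_mul, Nat.cast_add, ZMod.natCast_zmod_val, ← two_nsmul]
    exact h2
  obtain ⟨k, hk⟩ := (ZMod.natCast_eq_zero_iff _ _).mp h2'
  have hk1 : k = 1 := by
    rcases Nat.lt_or_ge k 2 with hk2 | hk2
    · interval_cases k
      · omega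
      · rfl
    · have : n * 2 ≤ n * k := Nat.mul_le_mul_left n hk2
      omega
  subst hk1
  rw [mul_one] at hk
  refine ⟨?_, ⟨x.val, by omega⟩⟩
  have hv : x.val = n / 2 := by omega
  rw [← hv, ZMod.natCast_zmod_val]

/-- An additive isomorphism onto `ℤ/n` sends a non-zero element killed by `2` to `n/2` (and `n` is even).
[folklore] -/
private theorem addEquiv_apply_eq_natCast_div_two {A : Type*} [AddCommGroup A] {n : ℕ} [NeZero n]
    (e : A ≃+ ZMod n) {a : A} (h2 : 2 • a = 0) (h0 : a ≠ 0) : e a = ((n / 2 : ℕ) : ZMod n) ∧ 2 ∣ n :=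
  zmod_eq_natCast_div_two (e a) (by rw [← map_nsmul, h2, map_zero]) (by rw [ne_eq, e.map_eq_zero_iff]; exact h0)

/-- `-1 ≠ 1` in the units of a field of characteristic `0`. [folklore] -/
private theorem neg_one_ne_one_units (F : Type*) [Field F] [CharZero F] : (-1 : Fˣ) ≠ 1 := by
  intro h
  have h' : ((-1 : Fˣ) : F) = ((1 : Fˣ) : F) := by rw [h]
  rw [Units.val_neg, Units.val_one] at h'
  have : (2 : F) = 0 := by linear_combination -h'
  exact two_ne_zero this

/-- A unit of a field with square `1`, other than `1`, is `-1`. [folklore] -/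
private theorem units_eq_neg_one_of_sq_eq_one {F : Type*} [Field F] {x : Fˣ} (h : x ^ 2 = 1) (h1 : x ≠ 1) :
    x = -1 := by
  have h' : (x : F) * (x : F) = 1 := by rw [← pow_two, ← Units.val_pow_eq_pow_val, h, Units.val_one]
  rcases mul_self_eq_one_iff.mp h' with h'' | h''
  · exact absurd (Units.ext h'') h1
  · exact Units.ext (by rw [h'', Units.val_neg, Units.val_one])

/-! ### §1. The archimedean invariant of a localised class, on a cocycle -/

section Archimedean

variable {K : Type u} [Field K] [NumberField K] {n : ℕ} [NeZero n] (w : InfinitePlace K)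

/-- **`inv_w (loc_w [φ]) = φ(c_w, c_w) + φ(1, 1)` read in `ℤ/n`**: the archimedean invariant of the
localisation at the infinite place `w` of the class of a `2`-cocycle `φ` of `Γ_K`, for `c` a non-trivial
element of `Γ_{K_w}` and `c_w = res c` (`archimedeanInvariantMap_twoCocycleClass` on the pulled-back
cocycle). [cite: MilneADT2006, Ch. I, Thm. 2.13] -/
theorem archimedeanInvariantMap_localization_twoCocycleClass
    {c : absoluteGaloisGroup (Place.Completion (K := K) (Sum.inl w))} (hc : c ≠ 1)
    (φ : haveI : CompactSpace (absoluteGaloisGroup K) := absoluteGaloisGroup_compactSpace K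
      contTwoCocycles (mu K n).toTopRep) :
    haveI : CompactSpace (absoluteGaloisGroup K) := absoluteGaloisGroup_compactSpace K
    haveI : CompactSpace (absoluteGaloisGroup (Place.Completion (K := K) (Sum.inl w))) :=
      absoluteGaloisGroup_compactSpace _
    archimedeanInvariantMap K n w (galoisCohomology.localization (mu K n) (Sum.inl w) 2 (twoCocycleClass _ φ)) =
      muCarrierZModEquiv K n
        (φ.1 (absGaloisRestrict K (Place.Completion (K := K) (Sum.inl w)) c,
            absGaloisRestrict K (Place.Completion (K := K) (Sum.inl w)) c) + φ.1 (1, 1)) := by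
  haveI : CompactSpace (absoluteGaloisGroup K) := absoluteGaloisGroup_compactSpace K
  haveI : CompactSpace (absoluteGaloisGroup (Place.Completion (K := K) (Sum.inl w))) :=
    absoluteGaloisGroup_compactSpace _
  haveI := finite_absoluteGaloisGroup_placeCompletion_inl K w
  have hG := natCard_absoluteGaloisGroup_placeCompletion_inl_le_two K w
  set res := absGaloisRestrict K (Place.Completion (K := K) (Sum.inl w)) with hres
  set P : contTwoCocycles ((mu K n).toLocal (Sum.inl w)).toTopRep := contTwoCocycles.pullback res
    (TopRep.ofHom ⟨ContinuousLinearMap.id ℤ (MuCarrier K n), fun _ => rfl⟩) φ with hPdef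
  have hP : ∀ x y, P.1 (x, y) = φ.1 (res x, res y) := fun _ _ => rfl
  have hloc : galoisCohomology.localization (mu K n) (Sum.inl w) 2 (twoCocycleClass _ φ) =
      twoCocycleClass ((mu K n).toLocal (Sum.inl w)).toTopRep P :=
    map_twoCocycleClass (Y := ((mu K n).toLocal (Sum.inl w)).toTopRep) (mu K n).toTopRep res
      (TopRep.ofHom ⟨ContinuousLinearMap.id ℤ (MuCarrier K n), fun _ => rfl⟩) φ
  rw [hloc, archimedeanInvariantMap_twoCocycleClass (K := K) (n := n) (w := w) P,
    twoCocycleDiagonal_of_ne_one (X := ((mu K n).toLocal (Sum.inl w)).toTopRep) hG hc P, hP, hP, map_one]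

/-- The diagonal `φ(c_w, c_w) + φ(1, 1)` of a `2`-cocycle of `Γ_K` at a real place is killed by `2`
(`inv_w` takes values in `{0, n/2}`, `two_nsmul_archimedeanInvariantMap`). [cite: MilneADT2006, Ch. I, Ex. 1.6 (c)] -/
theorem two_nsmul_diagonal_eq_zero {c : absoluteGaloisGroup (Place.Completion (K := K) (Sum.inl w))} (hc : c ≠ 1)
    (φ : haveI : CompactSpace (absoluteGaloisGroup K) := absoluteGaloisGroup_compactSpace K
      contTwoCocycles (mu K n).toTopRep) :
    2 • (φ.1 (absGaloisRestrict K (Place.Completion (K := K) (Sum.inl w)) c,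
        absGaloisRestrict K (Place.Completion (K := K) (Sum.inl w)) c) + φ.1 (1, 1)) = 0 := by
  haveI : CompactSpace (absoluteGaloisGroup K) := absoluteGaloisGroup_compactSpace K
  haveI : CompactSpace (absoluteGaloisGroup (Place.Completion (K := K) (Sum.inl w))) :=
    absoluteGaloisGroup_compactSpace _
  apply (muCarrierZModEquiv K n).injective
  rw [map_nsmul, map_zero, ← archimedeanInvariantMap_localization_twoCocycleClass w hc φ]
  exact two_nsmul_archimedeanInvariantMap _

end Archimedean

/-! ### §2. Level change for the archimedean invariants -/

section Levels

variable {K : Type u} [Field K] [NumberField K] {n : ℕ} [NeZero n] (w : InfinitePlace K)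

/-- `(n/2)·(N/n) = N/2` for `n` even dividing `N`. [folklore] -/
private theorem div_two_mul_div {n N : ℕ} (hn : n ≠ 0) (h2 : 2 ∣ n) (hN : n ∣ N) : n / 2 * (N / n) = N / 2 := by
  obtain ⟨a, rfl⟩ := h2
  obtain ⟨k, rfl⟩ := hN
  rw [Nat.mul_div_cancel_left a two_pos, Nat.mul_div_cancel_left k (Nat.pos_of_ne_zero hn), mul_assoc,
    Nat.mul_div_cancel_left (a * k) two_pos]

/-- **Level change for `inv_w` along `μₙ ⊆ μ_N`** (infinite place `w`, `n ∣ N`): for `x ∈ H²(Γ_K, μₙ)`,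
`inv_w^{(N)} (loc_w (H²(μₙ ⊆ μ_N) x)) = (N/n) · inv_w^{(n)} (loc_w x)` read in `ℤ/N` — the archimedean
invariant maps of the levels are compatible with `(1/n)ℤ/ℤ ⊆ (1/N)ℤ/ℤ`: the diagonal of the class is an
element of `μₙ[2]`, `0 ↦ 0` and `-1 ↦ -1`, i.e. `n/2 ↦ N/2 = (N/n)·(n/2)`.  Archimedean twin of
`localInvariantMap_localization_cohomologyMap_muInclHom`. [cite: SerreLocalFields1979, XIII §3 Cor. 3] -/
theorem archimedeanInvariantMap_localization_cohomologyMap_muInclHom {N : ℕ} [NeZero N] (hnN : n ∣ N)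
    (x : galoisCohomology (mu K n) 2) :
    haveI : CompactSpace (absoluteGaloisGroup K) := absoluteGaloisGroup_compactSpace K
    haveI : CompactSpace (absoluteGaloisGroup (Place.Completion (K := K) (Sum.inl w))) :=
      absoluteGaloisGroup_compactSpace _
    archimedeanInvariantMap K N w (galoisCohomology.localization (mu K N) (Sum.inl w) 2
        (cohomologyMap (muInclHom K hnN) 2 x)) =
      (((archimedeanInvariantMap K n w (galoisCohomology.localization (mu K n) (Sum.inl w) 2 x)).val *
        (N / n) : ℕ) : ZMod N) := by
  haveI : CompactSpace (absoluteGaloisGroup K) := absoluteGaloisGroup_compactSpace K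
  haveI : CompactSpace (absoluteGaloisGroup (Place.Completion (K := K) (Sum.inl w))) :=
    absoluteGaloisGroup_compactSpace _
  rcases w.isReal_or_isComplex with hw | hw
  swap
  · -- complex place: both sides vanish
    rw [archimedeanInvariantMap_eq_zero_of_isComplex hw, archimedeanInvariantMap_eq_zero_of_isComplex hw,
      ZMod.val_zero, zero_mul, Nat.cast_zero]
  obtain ⟨c, hc⟩ := exists_ne_one_absoluteGaloisGroup_of_isReal (K := K) hw
  obtain ⟨φ, rfl⟩ := twoCocycleClass_surjective (mu K n).toTopRep x
  set res := absGaloisRestrict K (Place.Completion (K := K) (Sum.inl w)) with hres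
  -- the raised class and its diagonal
  rw [cohomologyMap_twoCocycleClass, archimedeanInvariantMap_localization_twoCocycleClass w hc,
    archimedeanInvariantMap_localization_twoCocycleClass w hc, pullback₂_id_resIdHom_apply,
    pullback₂_id_resIdHom_apply, muInclHom_hom_apply, muInclHom_hom_apply, ← map_add]
  set D : MuCarrier K n := φ.1 (res c, res c) + φ.1 (1, 1) with hD
  have hD2 : 2 • D = 0 := two_nsmul_diagonal_eq_zero w hc φ
  by_cases hD0 : D = 0
  · rw [hD0, map_zero, map_zero, map_zero, ZMod.val_zero, zero_mul, Nat.cast_zero]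
  -- `D ≠ 0`: `D ↦ n/2`, `ι D ↦ N/2`
  obtain ⟨hDn, h2n⟩ := addEquiv_apply_eq_natCast_div_two (muCarrierZModEquiv K n) hD2 hD0
  have hιD0 : muInclusion K hnN D ≠ 0 := by
    intro h
    apply hD0
    apply muVal_injective K n
    rw [← muVal_muInclusion K hnN D, h, muVal_zero, muVal_zero]
  have hιD2 : 2 • muInclusion K hnN D = 0 := by rw [← map_nsmul, hD2, map_zero]
  obtain ⟨hDN, -⟩ := addEquiv_apply_eq_natCast_div_two (muCarrierZModEquiv K N) hιD2 hιD0
  rw [hDN, hDn, ZMod.val_natCast, Nat.mod_eq_of_lt (Nat.div_lt_self (NeZero.pos n) one_lt_two),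
    div_two_mul_div (NeZero.ne n) h2n hnN]

/-- **Level change for `inv_w` along `μ_N ↠ μₙ`** (infinite place `w`, `n d = N`): for
`x ∈ H²(Γ_K, μ_N)`, `inv_w^{(n)} (loc_w (H²(μ_N ↠ μₙ) x))` is the reduction `ℤ/N ↠ ℤ/n` of
`inv_w^{(N)} (loc_w x)`: the diagonal `-1 ∈ μ_N` goes to `(-1)^d`, and `N/2 = nd/2 ≡ [d odd]·n/2 (mod n)`.
Archimedean twin of `localInvariantMap_localization_cohomologyMap_muPowHom`.
[cite: SerreLocalFields1979, XIII §3 Cor. 3] -/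
theorem archimedeanInvariantMap_localization_cohomologyMap_muPowHom {N d : ℕ} [NeZero N] (h : n * d = N)
    (x : galoisCohomology (mu K N) 2) :
    haveI : CompactSpace (absoluteGaloisGroup K) := absoluteGaloisGroup_compactSpace K
    haveI : CompactSpace (absoluteGaloisGroup (Place.Completion (K := K) (Sum.inl w))) :=
      absoluteGaloisGroup_compactSpace _
    archimedeanInvariantMap K n w (galoisCohomology.localization (mu K n) (Sum.inl w) 2
        (cohomologyMap (muPowHom K N n d h) 2 x)) =
      ZMod.castHom (Dvd.intro d h) (ZMod n)
        (archimedeanInvariantMap K N w (galoisCohomology.localization (mu K N) (Sum.inl w) 2 x)) := by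
  haveI : CompactSpace (absoluteGaloisGroup K) := absoluteGaloisGroup_compactSpace K
  haveI : CompactSpace (absoluteGaloisGroup (Place.Completion (K := K) (Sum.inl w))) :=
    absoluteGaloisGroup_compactSpace _
  have hnN : n ∣ N := Dvd.intro d h
  rcases w.isReal_or_isComplex with hw | hw
  swap
  · rw [archimedeanInvariantMap_eq_zero_of_isComplex hw, archimedeanInvariantMap_eq_zero_of_isComplex hw, map_zero]
  obtain ⟨c, hc⟩ := exists_ne_one_absoluteGaloisGroup_of_isReal (K := K) hw
  obtain ⟨φ, rfl⟩ := twoCocycleClass_surjective (mu K N).toTopRep x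
  set res := absGaloisRestrict K (Place.Completion (K := K) (Sum.inl w)) with hres
  rw [cohomologyMap_twoCocycleClass, archimedeanInvariantMap_localization_twoCocycleClass w hc,
    archimedeanInvariantMap_localization_twoCocycleClass w hc, pullback₂_id_resIdHom_apply,
    pullback₂_id_resIdHom_apply, muPowHom_hom_apply, muPowHom_hom_apply, ← map_add]
  set D : MuCarrier K N := φ.1 (res c, res c) + φ.1 (1, 1) with hD
  have hD2 : 2 • D = 0 := two_nsmul_diagonal_eq_zero w hc φ
  by_cases hD0 : D = 0
  · rw [hD0, map_zero, map_zero, map_zero, map_zero]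
  obtain ⟨hDN, -⟩ := addEquiv_apply_eq_natCast_div_two (muCarrierZModEquiv K N) hD2 hD0
  rw [hDN, map_natCast]
  -- `muVal D = -1`
  have hDval : muVal K N D = -1 := by
    refine units_eq_neg_one_of_sq_eq_one ?_ fun h1 => hD0 (muVal_injective K N (by rw [h1, muVal_zero]))
    rw [← muVal_nsmul, hD2, muVal_zero]
  have hpow : muVal K n (muPow K N n d h D) = (-1) ^ d := by rw [muVal_muPow, hDval]
  rcases Nat.even_or_odd d with hd | hd
  · -- `d` even: `(-1)^d = 1`, and `N/2 = n·(d/2) ≡ 0 (mod n)`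
    have h0 : muPow K N n d h D = 0 := muVal_injective K n (by rw [hpow, hd.neg_one_pow, muVal_zero])
    rw [h0, map_zero]
    obtain ⟨j, hj⟩ := hd
    have hN2 : N / 2 = n * j := by rw [← h, hj, ← two_mul, ← mul_assoc, mul_comm n 2, mul_assoc, Nat.mul_div_cancel_left _ two_pos]
    rw [hN2, (ZMod.natCast_eq_zero_iff _ _).mpr (dvd_mul_right n j)]
  · -- `d` odd: `(-1)^d = -1 ≠ 1`, and `N/2 ≡ n/2 (mod n)`
    have hP0 : muPow K N n d h D ≠ 0 := by
      intro h0
      have := congrArg (muVal K n) h0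
      rw [hpow, hd.neg_one_pow, muVal_zero] at this
      exact neg_one_ne_one_units (AlgebraicClosure K) this
    have hP2 : 2 • muPow K N n d h D = 0 := by rw [← map_nsmul, hD2, map_zero]
    obtain ⟨hPn, h2n⟩ := addEquiv_apply_eq_natCast_div_two (muCarrierZModEquiv K n) hP2 hP0
    rw [hPn]
    obtain ⟨j, hj⟩ := hd
    obtain ⟨a, ha⟩ := h2n
    have hN2 : N / 2 = n * j + n / 2 := by
      rw [← h, hj, ha, Nat.mul_div_cancel_left a two_pos]
      have : 2 * a * (2 * j + 1) = 2 * (2 * a * j + a) := by ring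
      rw [this, Nat.mul_div_cancel_left _ two_pos]
    rw [hN2, Nat.cast_add, (ZMod.natCast_eq_zero_iff _ _).mpr (dvd_mul_right n j), zero_add]

end Levels

/-! ### §3. Level change for the canonical family, uniformly in the place -/

section Canonical

variable {K : Type u} [Field K] [NumberField K] {n : ℕ} [NeZero n]

/-- **Level change for THE invariant maps along `μₙ ⊆ μ_N`, every place**:
`inv_v^{(N)} (loc_v (ι_* x)) = (N/n) · inv_v^{(n)} (loc_v x)` (finite places:
`localInvariantMap_localization_cohomologyMap_muInclHom`; infinite places:
`archimedeanInvariantMap_localization_cohomologyMap_muInclHom`). [cite: SerreLocalFields1979, XIII §3 Cor. 3] -/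
theorem canonical_localization_cohomologyMap_muInclHom {N : ℕ} [NeZero N] (hnN : n ∣ N) (v : Place K)
    (x : galoisCohomology (mu K n) 2) :
    haveI : CompactSpace (absoluteGaloisGroup K) := absoluteGaloisGroup_compactSpace K
    LocalInvariants.canonical K N v (galoisCohomology.localization (mu K N) v 2 (cohomologyMap (muInclHom K hnN) 2 x)) =
      (((LocalInvariants.canonical K n v (galoisCohomology.localization (mu K n) v 2 x)).val * (N / n) : ℕ) :
        ZMod N) := by
  rcases v with w | v
  · rw [LocalInvariants.canonical_inl, LocalInvariants.canonical_inl]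
    exact archimedeanInvariantMap_localization_cohomologyMap_muInclHom w hnN x
  · rw [LocalInvariants.canonical_inr, LocalInvariants.canonical_inr]
    exact localInvariantMap_localization_cohomologyMap_muInclHom hnN v x

/-- **Level change for THE invariant maps along `μ_N ↠ μₙ`, every place** (`n d = N`):
`inv_v^{(n)} (loc_v (π_* x)) = inv_v^{(N)} (loc_v x) mod n`. [cite: SerreLocalFields1979, XIII §3 Cor. 3] -/
theorem canonical_localization_cohomologyMap_muPowHom {N d : ℕ} [NeZero N] (h : n * d = N) (v : Place K)
    (x : galoisCohomology (mu K N) 2) :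
    haveI : CompactSpace (absoluteGaloisGroup K) := absoluteGaloisGroup_compactSpace K
    LocalInvariants.canonical K n v (galoisCohomology.localization (mu K n) v 2 (cohomologyMap (muPowHom K N n d h) 2 x)) =
      ZMod.castHom (Dvd.intro d h) (ZMod n)
        (LocalInvariants.canonical K N v (galoisCohomology.localization (mu K N) v 2 x)) := by
  rcases v with w | v
  · rw [LocalInvariants.canonical_inl, LocalInvariants.canonical_inl]
    exact archimedeanInvariantMap_localization_cohomologyMap_muPowHom w h x
  · rw [LocalInvariants.canonical_inr, LocalInvariants.canonical_inr]
    exact localInvariantMap_localization_cohomologyMap_muPowHom h v x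

end Canonical

/-! ### §4. The primary reduction over an arbitrary number field -/

section Reduction

variable {K : Type u} [Field K] [NumberField K]

/-- **The reciprocity law for the canonical family at level `a·b` from the levels `a`, `b` (coprime),
every number field `K`** — the proof of `sumInvLocalizationEqZero_canonical_of_coprime` with the
place-uniform level changes `canonical_localization_cohomologyMap_muInclHom/_muPowHom` (real places
included). [cite: CasselsFrohlich1967, Ch. VII §11] [cite: SerreLocalFields1979, XIII §3 Cor. 3] -/
theorem sumInvLocalizationEqZero_canonical_of_coprime_of_numberField {a b n : ℕ} [NeZero a]
    [NeZero b] [NeZero n] (hn : a * b = n) (hab : a.Coprime b)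
    (ha : (LocalInvariants.canonical K a).SumInvLocalizationEqZero)
    (hb : (LocalInvariants.canonical K b).SumInvLocalizationEqZero) :
    (LocalInvariants.canonical K n).SumInvLocalizationEqZero := by
  haveI : CompactSpace (absoluteGaloisGroup K) := absoluteGaloisGroup_compactSpace K
  intro c S hS
  have hn' : b * a = n := by rw [mul_comm, hn]
  -- Bezout
  obtain ⟨e, f, hef⟩ := Nat.isCoprime_iff_coprime.2 hab
  -- the embeddings `ℤ/m ↪ ℤ/n`, `k ↦ k·(n/m)`, as additive maps
  have hΨ : ∀ {m d : ℕ} [NeZero m], m * d = n →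
      ∃ Ψ : ZMod m →+ ZMod n, ∀ k : ZMod m, Ψ k = ((k.val * d : ℕ) : ZMod n) := by
    intro m d _ hmd
    refine ⟨ZMod.lift m ⟨zmultiplesHom (ZMod n) (d : ZMod n), ?_⟩, fun k => ?_⟩
    · rw [zmultiplesHom_apply, natCast_zsmul, nsmul_eq_mul, ← Nat.cast_mul, hmd, ZMod.natCast_self]
    · have hk : ((k.val : ℤ) : ZMod m) = k := by rw [Int.cast_natCast, ZMod.natCast_zmod_val]
      conv_lhs => rw [← hk]
      rw [ZMod.lift_coe]
      change ((k.val : ℕ) : ℤ) • (d : ZMod n) = _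
      rw [natCast_zsmul, nsmul_eq_mul, Nat.cast_mul]
  obtain ⟨Ψb, hΨb⟩ := hΨ hn'
  obtain ⟨Ψa, hΨa⟩ := hΨ hn
  -- the two pieces `y_a = H²(μ_n ↠ μ_a) c`, `y_b = H²(μ_n ↠ μ_b) c`
  set ya : galoisCohomology (mu K a) 2 := cohomologyMap (muPowHom K n a b hn) 2 c with hya
  set yb : galoisCohomology (mu K b) 2 := cohomologyMap (muPowHom K n b a hn') 2 c with hyb
  have hbc : (b : ℤ) • c = cohomologyMap (muInclHom K (Dvd.intro b hn)) 2 ya := by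
    rw [hya, natCast_zsmul]
    exact (cohomologyMap_muInclHom_muPowHom K hn c).symm
  have hac : (a : ℤ) • c = cohomologyMap (muInclHom K (Dvd.intro a hn')) 2 yb := by
    rw [hyb, natCast_zsmul]
    exact (cohomologyMap_muInclHom_muPowHom K hn' c).symm
  have hNa : n / b = a := by rw [← hn', Nat.mul_div_cancel_left a (NeZero.pos b)]
  have hNb : n / a = b := by rw [← hn, Nat.mul_div_cancel_left b (NeZero.pos a)]
  -- the local terms, place by place (all places uniformly)
  have key : ∀ v : Place K,
      LocalInvariants.canonical K n v (galoisCohomology.localization (mu K n) v 2 c) =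
        e • Ψb (LocalInvariants.canonical K b v
            (galoisCohomology.localization (mu K b) v 2 yb)) +
          f • Ψa (LocalInvariants.canonical K a v
            (galoisCohomology.localization (mu K a) v 2 ya)) := by
    intro v
    -- the invariant at `v` as an additive function of the global class
    set Φ : galoisCohomology (mu K n) 2 →+ ZMod n :=
      (LocalInvariants.canonical K n v).comp
        (galoisCohomology.localization (mu K n) v 2) with hΦ
    have hΦc : Φ c = e • Φ ((a : ℤ) • c) + f • Φ ((b : ℤ) • c) := by
      rw [map_zsmul, map_zsmul, smul_smul, smul_smul, ← add_smul, hef, one_smul]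
    change Φ c = _
    rw [hΦc, hac, hbc, hΦ, AddMonoidHom.comp_apply, AddMonoidHom.comp_apply,
      canonical_localization_cohomologyMap_muInclHom, canonical_localization_cohomologyMap_muInclHom,
      hΨb, hΨa, hNa, hNb]
  -- the pieces have vanishing invariants outside `S`
  have hSb : ∀ v ∉ S, LocalInvariants.canonical K b v
      (galoisCohomology.localization (mu K b) v 2 yb) = 0 := by
    intro v hv
    rw [hyb, canonical_localization_cohomologyMap_muPowHom, hS _ hv, map_zero]
  have hSa : ∀ v ∉ S, LocalInvariants.canonical K a v
      (galoisCohomology.localization (mu K a) v 2 ya) = 0 := by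
    intro v hv
    rw [hya, canonical_localization_cohomologyMap_muPowHom, hS _ hv, map_zero]
  -- sum up
  rw [Finset.sum_congr rfl fun v _ => key v, Finset.sum_add_distrib, ← Finset.smul_sum,
    ← Finset.smul_sum, ← map_sum, ← map_sum, hb yb S hSb, ha ya S hSa, map_zero, map_zero,
    smul_zero, smul_zero, add_zero]

/-- **Reduction of the reciprocity law for THE invariant maps to prime-power levels, every number field
`K`**: if `(LocalInvariants.canonical K q).SumInvLocalizationEqZero` for every prime power `q`, then for
every level `n ≥ 1` (the proof of `sumInvLocalizationEqZero_canonical_of_primePow`, with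
`sumInvLocalizationEqZero_canonical_of_coprime_of_numberField`). [cite: CasselsFrohlich1967, Ch. VII §11] -/
theorem sumInvLocalizationEqZero_canonical_of_primePow_of_numberField
    (h : ∀ (q : ℕ) [NeZero q], IsPrimePow q → (LocalInvariants.canonical K q).SumInvLocalizationEqZero)
    (n : ℕ) [NeZero n] : (LocalInvariants.canonical K n).SumInvLocalizationEqZero := by
  -- strong induction on the level, generalising the `NeZero` instance
  have main : ∀ (m : ℕ) (_ : NeZero m), (LocalInvariants.canonical K m).SumInvLocalizationEqZero := by
    intro m
    induction m using Nat.strong_induction_on with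
    | _ m ih =>
      intro _
      rcases Nat.lt_or_ge 1 m with hm1 | hm1
      swap
      · -- `m = 1`: `ℤ/1` is trivial
        have hm : m = 1 := le_antisymm hm1 (NeZero.pos m)
        subst hm
        intro c S _
        exact Subsingleton.elim _ _
      -- split off the `p`-primary part of `m` for a prime `p ∣ m`
      obtain ⟨p, hp, hpm⟩ := Nat.exists_prime_and_dvd (ne_of_gt hm1)
      have hm0 : m ≠ 0 := NeZero.ne m
      have habm : ordProj[p] m * ordCompl[p] m = m := Nat.ordProj_mul_ordCompl_eq_self m p
      have hab : (ordProj[p] m).Coprime (ordCompl[p] m) := (Nat.coprime_ordCompl hp hm0).pow_left _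
      have hk : 0 < m.factorization p := Nat.Prime.factorization_pos_of_dvd hp hm0 hpm
      haveI : NeZero (ordProj[p] m) := ⟨pow_ne_zero _ hp.ne_zero⟩
      have hb0 : 0 < ordCompl[p] m := Nat.ordCompl_pos p hm0
      haveI hb : NeZero (ordCompl[p] m) := ⟨hb0.ne'⟩
      have ha1 : 1 < ordProj[p] m := Nat.one_lt_pow hk.ne' hp.one_lt
      have hbm : ordCompl[p] m < m := by
        calc ordCompl[p] m = 1 * ordCompl[p] m := (one_mul _).symm
          _ < ordProj[p] m * ordCompl[p] m := Nat.mul_lt_mul_of_pos_right ha1 hb0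
          _ = m := habm
      exact sumInvLocalizationEqZero_canonical_of_coprime_of_numberField habm hab
        (h (ordProj[p] m) ⟨p, m.factorization p, hp.prime, hk, rfl⟩) (ih _ hbm hb)
  exact main n inferInstance

end Reduction

end Literature.NumberTheory.GaloisCohomology

end
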